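import Literature.Computability.AlgebraicComplexity.GroupTheoreticMatMul
import Mathlib.Algebra.BigOperators.Group.Finset.Sigma
import Mathlib.Data.Fintype.Card

/-!
# ω-census, family (b′): the single-block volume bound and the three-sumset packing bound (filters N1, N3)

HONEST FRAMING (pub-omega census; verbatim): lottery ticket; floor = certified bounds/negative ranges.
Census bookkeeping, not progress on `ω`: two elementary counting consequences of the simultaneous triple
product property (tree predicate `IsSTPP`, additive abelian groups) used as FILTERS by the STPP
block-pattern census of small groups (pub-omega-stpp-2, ENGINE.md §B, conditions N1 (abelian part) and N3).

* N1 (Cohn–Umans 2003, proof of Lemma 2.x: "If `G` is abelian, then the product map `S₁ × S₂ × S₃ → G`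
  must be injective, so `|G| ≥ n₁n₂n₃`"): for every block `i`, `|Aᵢ||Bᵢ||Cᵢ| ≤ |H|`
  (`stpp_card_mul_card_mul_card_le`).  In particular a single abelian TPP triple never beats `|H|`.
* N3: for two distinct blocks `i ≠ k` (all sets nonempty), `|Aᵢ||Bᵢ| + |Aᵢ||Cᵢ| + |Bᵢ||Cᵢ| ≤ |H|`
  (`stpp_three_pair_products_le`).  Reading the defining implication of `IsSTPP` as
  "`s' + t' + u' = s + t + u` with `(s',t',u') ∈ Aᵢ × Bⱼ × C_k`, `(s,t,u) ∈ A_k × Bᵢ × Cⱼ` forces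
  `i = j = k`", the three translates `Aᵢ + Bᵢ + u₀` (`u₀ ∈ C_k`), `Aᵢ + t₀ + Cᵢ` (`t₀ ∈ B_k`),
  `s₀ + Bᵢ + Cᵢ` (`s₀ ∈ A_k`) are pairwise disjoint (index patterns `(i,i,k)`, `(i,k,i)`, `(k,i,i)`) and
  have `|Aᵢ||Bᵢ|`, `|Aᵢ||Cᵢ|`, `|Bᵢ||Cᵢ|` elements (pattern `(i,i,i)`).

References: H. Cohn, C. Umans, FOCS 2003 (arXiv:math/0307321), Lemma 2.x (pseudo-exponent of abelian groups
is 3); H. Cohn, R. Kleinberg, B. Szegedy, C. Umans, FOCS 2005 (arXiv:math/0511460), Def. 5.1.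
-/

open Finset

namespace Summit.MatrixMultiplication.OmegaCensus

open Literature.Computability.AlgebraicComplexity

variable {H : Type*} [AddCommGroup H] {N : ℕ} {A B C : Fin N → Finset H}

/-- **N1 (single-block volume bound).** In an STPP family over a finite abelian group every block
satisfies `|Aᵢ||Bᵢ||Cᵢ| ≤ |H|`: the map `(s, t, u) ↦ s + t + u` is injective on `Aᵢ × Bᵢ × Cᵢ`
(the triple product property of block `i`, pattern `(i,i,i)` of the definition).
[cite: CohnUmans2003, Lemma 2.x (abelian pseudo-exponent 3)] -/
theorem stpp_card_mul_card_mul_card_le [Fintype H] (hS : IsSTPP A B C) (i : Fin N) :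
    (A i).card * (B i).card * (C i).card ≤ Fintype.card H := by
  classical
  have hinj : Set.InjOn (fun q : H × H × H => q.1 + q.2.1 + q.2.2)
      (((A i) ×ˢ ((B i) ×ˢ (C i)) : Finset (H × H × H)) : Set _) := by
    rintro ⟨s', t', u'⟩ hq ⟨s, t, u⟩ hq' heq
    simp only [Finset.coe_product, Set.mem_prod, Finset.mem_coe] at hq hq'
    have hrel : (s' - s) + (t' - t) + (u' - u) = 0 := by
      have : s' + t' + u' = s + t + u := heq
      rw [← sub_eq_zero.2 this]; abel
    obtain ⟨-, -, h1, h2, h3⟩ := hS i i i s hq'.1 s' hq.1 t hq'.2.1 t' hq.2.1 u hq'.2.2 u' hq.2.2 hrel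
    subst h1; subst h2; subst h3; rfl
  have h := Finset.card_le_card_of_injOn _ (fun q _ => Finset.mem_coe.2 (Finset.mem_univ ((fun q : H × H × H => q.1 + q.2.1 + q.2.2) q))) hinj
  simpa [Finset.card_product, Finset.card_univ, mul_assoc] using h

/-- **N3 (three-sumset packing bound).** In an STPP family with all sets nonempty over a finite abelian
group, two distinct blocks `i ≠ k` force `|Aᵢ||Bᵢ| + |Aᵢ||Cᵢ| + |Bᵢ||Cᵢ| ≤ |H|`. [folklore] -/
theorem stpp_three_pair_products_le [Fintype H] (hS : IsSTPP A B C) (hA : ∀ i, (A i).Nonempty)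
    (hB : ∀ i, (B i).Nonempty) (hC : ∀ i, (C i).Nonempty) {i k : Fin N} (hik : i ≠ k) :
    (A i).card * (B i).card + (A i).card * (C i).card + (B i).card * (C i).card ≤ Fintype.card H := by
  classical
  obtain ⟨s₀, hs₀⟩ := hA k
  obtain ⟨t₀, ht₀⟩ := hB k
  obtain ⟨u₀, hu₀⟩ := hC k
  obtain ⟨a₁, ha₁⟩ := hA i
  obtain ⟨b₁, hb₁⟩ := hB i
  obtain ⟨c₁, hc₁⟩ := hC i
  -- E1 = A i + B i + u₀,  E2 = A i + t₀ + C i,  E3 = s₀ + B i + C i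
  set f1 : H × H → H := fun q => q.1 + q.2 + u₀ with hf1
  set f2 : H × H → H := fun q => q.1 + t₀ + q.2 with hf2
  set f3 : H × H → H := fun q => s₀ + q.1 + q.2 with hf3
  set E1 := ((A i) ×ˢ (B i)).image f1 with hE1
  set E2 := ((A i) ×ˢ (C i)).image f2 with hE2
  set E3 := ((B i) ×ˢ (C i)).image f3 with hE3
  have hc1 : E1.card = (A i).card * (B i).card := by
    rw [hE1, Finset.card_image_of_injOn, Finset.card_product]
    rintro ⟨s', t'⟩ hq ⟨s, t⟩ hq' heq
    simp only [Finset.coe_product, Set.mem_prod, Finset.mem_coe] at hq hq'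
    have hrel : (s' - s) + (t' - t) + (c₁ - c₁) = 0 := by
      have : s' + t' + u₀ = s + t + u₀ := heq
      have h2 : s' + t' = s + t := add_right_cancel this
      rw [sub_self, add_zero, ← sub_eq_zero.2 h2]; abel
    obtain ⟨-, -, h1, h2, -⟩ := hS i i i s hq'.1 s' hq.1 t hq'.2 t' hq.2 c₁ hc₁ c₁ hc₁ hrel
    subst h1; subst h2; rfl
  have hc2 : E2.card = (A i).card * (C i).card := by
    rw [hE2, Finset.card_image_of_injOn, Finset.card_product]
    rintro ⟨s', u'⟩ hq ⟨s, u⟩ hq' heq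
    simp only [Finset.coe_product, Set.mem_prod, Finset.mem_coe] at hq hq'
    have hrel : (s' - s) + (b₁ - b₁) + (u' - u) = 0 := by
      have : s' + t₀ + u' = s + t₀ + u := heq
      rw [sub_self, add_zero, ← sub_eq_zero.2 this]; abel
    obtain ⟨-, -, h1, -, h3⟩ := hS i i i s hq'.1 s' hq.1 b₁ hb₁ b₁ hb₁ u hq'.2 u' hq.2 hrel
    subst h1; subst h3; rfl
  have hc3 : E3.card = (B i).card * (C i).card := by
    rw [hE3, Finset.card_image_of_injOn, Finset.card_product]
    rintro ⟨t', u'⟩ hq ⟨t, u⟩ hq' heq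
    simp only [Finset.coe_product, Set.mem_prod, Finset.mem_coe] at hq hq'
    have hrel : (a₁ - a₁) + (t' - t) + (u' - u) = 0 := by
      have : s₀ + t' + u' = s₀ + t + u := heq
      rw [sub_self, zero_add, ← sub_eq_zero.2 this]; abel
    obtain ⟨-, -, -, h2, h3⟩ := hS i i i a₁ ha₁ a₁ ha₁ t hq'.1 t' hq.1 u hq'.2 u' hq.2 hrel
    subst h2; subst h3; rfl
  -- pairwise disjointness via the index patterns (i,k,i) [E2 primed vs E1], (k,i,i) [E3 vs E2], (i,i,k) [E1 vs E3]
  have hd12 : Disjoint E1 E2 := by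
    rw [Finset.disjoint_left]; intro y hy1 hy2
    rw [hE1, Finset.mem_image] at hy1; rw [hE2, Finset.mem_image] at hy2
    obtain ⟨⟨s₁, t₁⟩, hq1, rfl⟩ := hy1
    obtain ⟨⟨s₂, u₂⟩, hq2, heq⟩ := hy2
    simp only [Finset.mem_product] at hq1 hq2
    -- primed (s₂, t₀, u₂) ∈ A i × B k × C i (pattern (i,k,i)); unprimed (s₁, t₁, u₀) ∈ A i × B i × C k
    have hrel : (s₂ - s₁) + (t₀ - t₁) + (u₂ - u₀) = 0 := by
      have : s₂ + t₀ + u₂ = s₁ + t₁ + u₀ := heq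
      rw [← sub_eq_zero.2 this]; abel
    obtain ⟨hik', -, -, -, -⟩ := hS i k i s₁ hq1.1 s₂ hq2.1 t₁ hq1.2 t₀ ht₀ u₀ hu₀ u₂ hq2.2 hrel
    exact hik hik'
  have hd23 : Disjoint E2 E3 := by
    rw [Finset.disjoint_left]; intro y hy2 hy3
    rw [hE2, Finset.mem_image] at hy2; rw [hE3, Finset.mem_image] at hy3
    obtain ⟨⟨s₂, u₂⟩, hq2, rfl⟩ := hy2
    obtain ⟨⟨t₃, u₃⟩, hq3, heq⟩ := hy3
    simp only [Finset.mem_product] at hq2 hq3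
    -- primed (s₀, t₃, u₃) ∈ A k × B i × C i (pattern (k,i,i)); unprimed (s₂, t₀, u₂) ∈ A i × B k × C i
    have hrel : (s₀ - s₂) + (t₃ - t₀) + (u₃ - u₂) = 0 := by
      have : s₀ + t₃ + u₃ = s₂ + t₀ + u₂ := heq
      rw [← sub_eq_zero.2 this]; abel
    obtain ⟨hki, -, -, -, -⟩ := hS k i i s₂ hq2.1 s₀ hs₀ t₀ ht₀ t₃ hq3.1 u₂ hq2.2 u₃ hq3.2 hrel
    exact hik hki.symm
  have hd13 : Disjoint E1 E3 := by
    rw [Finset.disjoint_left]; intro y hy1 hy3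
    rw [hE1, Finset.mem_image] at hy1; rw [hE3, Finset.mem_image] at hy3
    obtain ⟨⟨s₁, t₁⟩, hq1, rfl⟩ := hy1
    obtain ⟨⟨t₃, u₃⟩, hq3, heq⟩ := hy3
    simp only [Finset.mem_product] at hq1 hq3
    -- primed (s₁, t₁, u₀) ∈ A i × B i × C k (pattern (i,i,k)); unprimed (s₀, t₃, u₃) ∈ A k × B i × C i
    have hrel : (s₁ - s₀) + (t₁ - t₃) + (u₀ - u₃) = 0 := by
      have : s₀ + t₃ + u₃ = s₁ + t₁ + u₀ := heq
      rw [← sub_eq_zero.2 this.symm]; abel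
    obtain ⟨-, hik', -, -, -⟩ := hS i i k s₀ hs₀ s₁ hq1.1 t₃ hq3.1 t₁ hq1.2 u₃ hq3.2 u₀ hu₀ hrel
    exact hik hik'
  have hunion : (E1 ∪ E2 ∪ E3).card = E1.card + E2.card + E3.card := by
    rw [Finset.card_union_of_disjoint (Finset.disjoint_union_left.2 ⟨hd13, hd23⟩),
      Finset.card_union_of_disjoint hd12]
  calc (A i).card * (B i).card + (A i).card * (C i).card + (B i).card * (C i).card
      = (E1 ∪ E2 ∪ E3).card := by rw [hunion, hc1, hc2, hc3]
    _ ≤ Fintype.card H := Finset.card_le_univ _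

end Summit.MatrixMultiplication.OmegaCensus
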